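import Summits.CriticalPhenomena.CardyFormulaZ2.Theorems.CardyUniqueLimitCardyRigidityDriverHalf
import Summits.CriticalPhenomena.CardyFormulaZ2.Theorems.CardyComplexConeParafermionToSLESixFamiliesFaceKernelPercFaceK1
import HarnessLib

/-!
# The two lattice inputs of the driver half of `stub_crossingMartingale` (crux `CardyRigidity`)

Crux `Summit.CriticalPhenomena.CardyFormulaZ2.Theses.CardyUniqueLimit.CardyRigidity`
(stmt-CriticalPhenomena-0746), line `crossing_martingale`, stub `stub_crossingMartingale`.  The
driver half (`Driver.exists_regularDriver_perc`, `Theorems/CardyUniqueLimitCardyRigidityDriverHalf.lean`)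
produces a regular driver (both signs) of every subsequential limit of the bond-`ℤ²` interfaces
from two inputs, both about the raw medial exploration polyline of critical bond percolation on
`ℤ²` read through converging chordal uniformizing maps (Kemppainen–Smirnov 2017 for this family;
research-level formalisations, shared with crux stmt-CriticalPhenomena-11389 of route
`CardyComplexCone`):

* `CaratheodoryNetSlitUniformity.PercFaceBoxTight` — KS box tightness (Prop. 3.2 with
  Thms. 3.9–3.10), which ALONE gives the lattice data `PercKSBoxData`
  (`FaceKernel.percKSBoxData_of_boxTight`: the kernel inputs (K1), (ULC) of the oriented face
  domains are theorems of the tree);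
* `PercDrivingTail D E` (this file) — uniform sub-exponential tails of the running maxima of the
  discrete capacity driving processes `drivingFunction φ_k ∘ bondInterfaceIn D (E δ_k)` along
  positive admissible meshes, through every system of approximating chordal maps `φ_k → φ` as in
  `PercKSBoxData` (KS Prop. 3.8 (1), eq. (19): `P(sup_{[0,t]} |W| > b) ≤ K e^{-c b/(4√t)}`
  uniformly over a family satisfying Condition G2); stated per Dobrushin domain and
  discretisation family, with parameters, so that a skeleton can register it as a stub.

Theorems: `exists_regularDriver_perc_of_tail` (per `(D, E)`: `PercKSBoxData` and
`PercDrivingTail D E` give the driver clauses of `stub_crossingMartingale` for either sign) and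
`exists_regularDriver_perc_of_boxTight` (the same from `PercFaceBoxTight`).
-/

noncomputable section

open MeasureTheory Filter Set Topology Metric
open scoped NNReal ENNReal
open UpperHalfPlane (upperHalfPlaneSet)
open Literature.Probability Literature.Probability.RandomPlanarGeometry
  Literature.Probability.LatticeModels Literature.Probability.Percolation
open scoped Literature.Probability.RandomPlanarGeometry.PathBorel
open Summit.CriticalPhenomena.CardyFormulaZ2.Cruxes.ParafermionToSLESixFamilies.CaratheodoryNetSlitUniformity
  (PercKSBoxData PercFaceBoxTight)
open Summit.CriticalPhenomena.CardyFormulaZ2.Cruxes.ParafermionToSLESixFamilies.FaceKernel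
  (percKSBoxData_of_boxTight)

namespace Summit.CriticalPhenomena.CardyFormulaZ2.Cruxes.CardyRigidity.CrossingMartingale
-- buildfix lane 2026-08-20: namespace-local alias(es) so that short names made ambiguous by the
-- 2026-08-15 Literature migration (old home vs re-exported new home, both in the import cone) resolve,
-- as in the accepted build, to the OLD home `Literature.Probability.Percolation`. No declaration text changes.
export Literature.Probability.Percolation (bondInterfaceIn bondInterfaceIn_apply)

namespace Driver

/-- **Uniform sub-exponential tails of the discrete driving processes of the bond-`ℤ²` interfaces
of the discretisation family `E` of `(D; a, b)`.**  For every chordal uniformizing map `φ` of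
`D`, positive admissible meshes `δ_k → 0` and every system `(D_k, φ_k)` of approximating Dobrushin
domains with chordal maps whose boundary extensions converge to that of `φ` ((U1), (U2),
`b_k → b`) and through which the interfaces are box-tight (the output of `PercKSBoxData`), for
every `t` there are `K`, `r > 0`, `n₀` with
`P_{1/2}(∃ u ≤ t, |drivingFunction φ_k (bondInterfaceIn D (E δ_k)) u| > n) ≤ K e^{-r n}` for all
integers `n ≥ n₀` and all large `k` — Kemppainen–Smirnov's Prop. 3.8 (1) (arXiv eq. (19):
`P(sup_{0 ≤ s ≤ t} |W_s| > b) ≤ K exp(-c b/(4√t))`, uniformly over a family of curve laws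
satisfying Condition G2) for the raw medial exploration polyline of critical bond percolation on
`ℤ²` (Condition G2 from the Russo–Seymour–Welsh bounds).  The tail input of the driver half of
`stub_crossingMartingale`; a predicate in `(D, E)`. -/
def PercDrivingTail (D : DobrushinDomain) (E : ℝ → DiscreteDobrushin) : Prop :=
  ∀ φ : ConformalEquiv upperHalfPlaneSet D.carrier, D.IsChordalUniformizing φ →
    ∀ δs : ℕ → ℝ, (∀ k, 0 < δs k) → Tendsto δs atTop (𝓝 0) →
      (∀ k, (E (δs k)).IsZdAdmissible) →
    ∀ (Ds : ℕ → DobrushinDomain) (φs : ∀ k, ConformalEquiv upperHalfPlaneSet (Ds k).carrier),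
      (∀ k, (Ds k).IsChordalUniformizing (φs k)) →
      (∀ R : ℝ, TendstoUniformlyOn (fun k ↦ (φs k).boundaryExtension) φ.boundaryExtension
        atTop ({z : ℂ | 0 ≤ z.im} ∩ closedBall 0 R)) →
      (∀ ε : ℝ, 0 < ε → ∃ r : ℝ, ∀ᶠ k in atTop, ∀ z : ℂ, z ∈ {z : ℂ | 0 ≤ z.im} → r ≤ ‖z‖ →
        dist ((φs k).boundaryExtension z) ((Ds k).pt 1) ≤ ε) →
      Tendsto (fun k ↦ (Ds k).pt 1) atTop (𝓝 (D.pt 1)) →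
      (∀ ε : ℝ≥0∞, 0 < ε → ∃ (δγ δW : ℕ → ℝ) (T : ℕ → ℝ≥0), (∀ j, 0 < δγ j) ∧
        (∀ j, 0 < δW j) ∧
        ∀ k, bondPercolation (zdGraph 2) half ((bondInterfaceIn D (E (δs k))) ⁻¹'
          ((fun p ↦ compactifiedClass (φs k).boundaryExtension ((Ds k).pt 1) p.1) ''
            {p : C(ℝ≥0, ℂ) × C(ℝ≥0, ℝ) | p ∈ generatedPairs ∧
              p.1 ∈ Process.modulusSet ({0} : Set ℂ) δγ ∧
              p.2 ∈ Process.modulusSet ({0} : Set ℝ) δW ∧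
              ∀ (j : ℕ) (t : ℝ≥0), T j ≤ t → (j : ℝ) ≤ ‖p.1 t‖})ᶜ) ≤ ε) →
    ∀ t : ℝ≥0, ∃ (K r : ℝ) (n₀ : ℕ), 0 < r ∧ ∀ n : ℕ, n₀ ≤ n → ∀ᶠ k in atTop,
      bondPercolation (zdGraph 2) half {ω | ∃ u, u ≤ t ∧
        (n : ℝ) < |drivingFunction (φs k) (bondInterfaceIn D (E (δs k)) ω) u|} ≤
        ENNReal.ofReal (K * Real.exp (-r * n))

/-- **The driver clauses of `stub_crossingMartingale` from `PercKSBoxData` and the tails of ONE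
discretisation family.**  For a discretisation family `E` of `(D; a, b)` with `PercDrivingTail D E`,
every subsequential limit law `μ` of its interfaces and every chordal uniformizing map `φ`: a
process `W` with strongly measurable marginals such that `W` and `-W` are regular drivers for the
natural filtration of `W`, `W = drivingFunction φ` a.e., and `μ`-a.e. curve is driven by `W`
through `φ`. [cite: KemppainenSmirnov2017, Thm. 1.5, Cor. 1.7, Cor. 1.8 and Prop. 3.8] -/
theorem exists_regularDriver_perc_of_tail (hKS : PercKSBoxData) {D : DobrushinDomain}
    {E : ℝ → DiscreteDobrushin} (hTail : PercDrivingTail D E) (hE : ZdDiscretisationFamily D E)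
    (μ : Measure (CurveClass ℂ)) [IsProbabilityMeasure μ]
    (hlim : IsSubseqLimitLaw (fun δ ↦ bondInterfaceIn D (E δ))
      (fun _ ↦ bondPercolation (zdGraph 2) half) μ)
    {φ : ConformalEquiv upperHalfPlaneSet D.carrier} (hφ : D.IsChordalUniformizing φ) :
    ∃ (W : CurveClass ℂ → ℝ≥0 → ℝ) (hWm : ∀ t, StronglyMeasurable (fun c ↦ W c t)),
      IsRegularDriver μ W (Filtration.natural (fun t c ↦ W c t) hWm) ∧
      IsRegularDriver μ (fun c t ↦ -W c t) (Filtration.natural (fun t c ↦ W c t) hWm) ∧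
      (∀ᵐ c ∂μ, W c = drivingFunction φ c) ∧
      (∀ᵐ c ∂μ, Loewner.IsDrivenBy φ.boundaryExtension (D.pt 1) (W c) c) := by
  obtain ⟨hdesc, hsrc, δs, Ds, φs, hδpos, hδ0, hδadm, hφs, hU1, hU2, hb, hbox, hTD⟩ :=
    percLimitData_of_percKSBoxData hKS hE hlim hφ
  have htail := hTail φ hφ δs hδpos hδ0 hδadm Ds φs hφs hU1 hU2 hb hbox
  haveI : ∀ k : ℕ, IsProbabilityMeasure ((fun _ : ℕ ↦ bondPercolation (zdGraph 2) half) k) :=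
    fun _ ↦ by dsimp only; infer_instance
  exact exists_regularDriver_of_limitData (P := fun _ ↦ bondPercolation (zdGraph 2) half)
    (V := fun k u ω ↦ drivingFunction (φs k) (bondInterfaceIn D (E (δs k)) ω) u) hφ hdesc hsrc
    (fun k ω ↦ continuous_drivingFunction (φs k) (bondInterfaceIn D (E (δs k)) ω)) hTD htail

/-- **The driver clauses of `stub_crossingMartingale` from Kemppainen–Smirnov box tightness and
the tails.**  `PercFaceBoxTight` alone gives `PercKSBoxData`
(`FaceKernel.percKSBoxData_of_boxTight`), so the driver half rests on the two Kemppainen–Smirnov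
inputs for the bond-`ℤ²` exploration: box tightness and the driving tails.
[cite: KemppainenSmirnov2017, Thm. 1.5, Prop. 3.2 and Prop. 3.8] -/
theorem exists_regularDriver_perc_of_boxTight (hBT : PercFaceBoxTight) {D : DobrushinDomain}
    {E : ℝ → DiscreteDobrushin} (hTail : PercDrivingTail D E) (hE : ZdDiscretisationFamily D E)
    (μ : Measure (CurveClass ℂ)) [IsProbabilityMeasure μ]
    (hlim : IsSubseqLimitLaw (fun δ ↦ bondInterfaceIn D (E δ))
      (fun _ ↦ bondPercolation (zdGraph 2) half) μ)
    {φ : ConformalEquiv upperHalfPlaneSet D.carrier} (hφ : D.IsChordalUniformizing φ) :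
    ∃ (W : CurveClass ℂ → ℝ≥0 → ℝ) (hWm : ∀ t, StronglyMeasurable (fun c ↦ W c t)),
      IsRegularDriver μ W (Filtration.natural (fun t c ↦ W c t) hWm) ∧
      IsRegularDriver μ (fun c t ↦ -W c t) (Filtration.natural (fun t c ↦ W c t) hWm) ∧
      (∀ᵐ c ∂μ, W c = drivingFunction φ c) ∧
      (∀ᵐ c ∂μ, Loewner.IsDrivenBy φ.boundaryExtension (D.pt 1) (W c) c) :=
  exists_regularDriver_perc_of_tail (percKSBoxData_of_boxTight hBT) hTail hE μ hlim hφ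

/-- **In the format of `stub_crossingMartingale`** (existential over `(W, 𝓕, s)` with the sign):
box tightness and the tails give, for every subsequential limit and chordal `φ`, and for EITHER
prescribed sign `s = ±1`, a regular driver `W'` for a filtration `𝓕` with `μ`-a.e. curve driven
by `s * W'` — namely `W' = s * W` for the driving function `W`. [folklore] -/
theorem exists_regularDriver_perc_sign (hBT : PercFaceBoxTight) {D : DobrushinDomain}
    {E : ℝ → DiscreteDobrushin} (hTail : PercDrivingTail D E) (hE : ZdDiscretisationFamily D E)
    (μ : Measure (CurveClass ℂ)) [IsProbabilityMeasure μ]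
    (hlim : IsSubseqLimitLaw (fun δ ↦ bondInterfaceIn D (E δ))
      (fun _ ↦ bondPercolation (zdGraph 2) half) μ)
    {φ : ConformalEquiv upperHalfPlaneSet D.carrier} (hφ : D.IsChordalUniformizing φ)
    {s : ℝ} (hs : s = 1 ∨ s = -1) :
    ∃ (W' : CurveClass ℂ → ℝ≥0 → ℝ)
      (𝓕 : Filtration ℝ≥0 (inferInstance : MeasurableSpace (CurveClass ℂ))),
      IsRegularDriver μ W' 𝓕 ∧
      (∀ᵐ c ∂μ, Loewner.IsDrivenBy φ.boundaryExtension (D.pt 1) (fun t ↦ s * W' c t) c) ∧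
      (∀ᵐ c ∂μ, ∀ t, s * W' c t = drivingFunction φ c t) := by
  obtain ⟨W, hWm, hreg, -, hWae, hdrv⟩ := exists_regularDriver_perc_of_boxTight hBT hTail hE μ hlim hφ
  have hss : s * s = 1 := by rcases hs with rfl | rfl <;> norm_num
  refine ⟨fun c t ↦ s * W c t, Filtration.natural (fun t c ↦ W c t) hWm,
    isRegularDriver_smul_sign hreg hs, ?_, ?_⟩
  · filter_upwards [hdrv] with c hc
    have : (fun t ↦ s * (s * W c t)) = W c := by
      funext t
      rw [← mul_assoc, hss, one_mul]
    rw [this]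
    exact hc
  · filter_upwards [hWae] with c hc t
    rw [← mul_assoc, hss, one_mul, hc]

/-- **Registered form** (glue sub-goal `driver_exists_regularDriver_perc_of_boxTight` of
stmt-CriticalPhenomena-0746): the driver clauses of `stub_crossingMartingale` from Kemppainen–Smirnov
box tightness `PercFaceBoxTight` and the driving tails `PercDrivingTail D E` of the discretisation
family. [cite: KemppainenSmirnov2017, Thm. 1.5, Prop. 3.2 and Prop. 3.8] -/
theorem driver_exists_regularDriver_perc_of_boxTight : PercFaceBoxTight → ∀ {D : DobrushinDomain} {E : ℝ → DiscreteDobrushin}, PercDrivingTail D E → ZdDiscretisationFamily D E → ∀ (μ : MeasureTheory.Measure (CurveClass ℂ)) [MeasureTheory.IsProbabilityMeasure μ], IsSubseqLimitLaw (fun δ ↦ bondInterfaceIn D (E δ)) (fun _ ↦ bondPercolation (zdGraph 2) half) μ → ∀ {φ : ConformalEquiv upperHalfPlaneSet D.carrier}, D.IsChordalUniformizing φ → ∃ (W : CurveClass ℂ → ℝ≥0 → ℝ) (hWm : ∀ t, MeasureTheory.StronglyMeasurable (fun c ↦ W c t)), IsRegularDriver μ W (MeasureTheory.Filtration.natural (fun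 t c ↦ W c t) hWm) ∧ IsRegularDriver μ (fun c t ↦ -W c t) (MeasureTheory.Filtration.natural (fun t c ↦ W c t) hWm) ∧ (∀ᵐ c ∂μ, W c = drivingFunction φ c) ∧ (∀ᵐ c ∂μ, Loewner.IsDrivenBy φ.boundaryExtension (D.pt 1) (W c) c) :=
  fun hBT _ _ hTail hE μ _ hlim _ hφ ↦ exists_regularDriver_perc_of_boxTight hBT hTail hE μ hlim hφ

end Driver

end Summit.CriticalPhenomena.CardyFormulaZ2.Cruxes.CardyRigidity.CrossingMartingale

end
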